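import Literature.Probability.LatticeModels.PlaneRotatorHighTemperaturePhaseOpen
import Literature.Probability.LatticeModels.PlaneRotatorLiebNearestNeighbourBound
import Literature.Probability.LatticeModels.PlaneRotatorPathFloor
import Literature.Probability.LatticeModels.CorrelationDecay
import HarnessLib

/-!
# The correlation length of the plane-rotator comparison model as a typed object:
# the massive phase IS the high-temperature phase `K < K_χ(ν)`, and closed-form windows for the mass gap

Topic `Literature/Probability/LatticeModels`. For the nearest-neighbour plane rotator (classical XY model) on `ℤ^ν`
at reduced coupling `K = βJ = J/T ≥ 0` (free boundary conditions), with infinite-volume two-point function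
`G_K(0, x) = PlaneRotator.infTwoPoint K ν 0 x` (B. Simon, Comm. Math. Phys. **77** (1980) 111, Thm 1.3), the tree's
generic decay vocabulary (`CorrelationDecay.lean`: `HasExponentialDecay`, `HasExponentialDecayRate`, rates in the
`ℓ^∞` norm `‖x‖ = ‖x‖_∞`, S. Friedli, Y. Velenik, *Statistical Mechanics of Lattice Systems* (2017) §3.7.4 / §3.10.7)
gets a referent: the **mass gap** (inverse correlation length)

`PlaneRotator.massGap K ν := sup {m : |G_K(0, x)| ≤ C·e^{−m‖x‖_∞} for some C and all x} ∈ [0, ∞]`,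

`ξ(K) = 1/massGap K ν` being the correlation length (`0` = "`ξ = ∞`", `∞` = "`ξ = 0`"; no junk values). PROVED:

* §1 `infTwoPoint_mono_coupling` (Griffiths–Ginibre in `K`, pointwise), `infTwoPoint_le_pow_besselRatio`
  (**Lieb's Theorem 4 in infinite volume**: `G_K(0, x) ≤ (2ν·u(K))^{‖x‖₁}`, `u = I₁/I₀`, E. H. Lieb, Comm. Math. Phys.
  **77** (1980) 127), `pow_besselRatio_le_infTwoPoint_single` (**Ginibre's path floor along an axis**:
  `u(K)^n ≤ G_K(0, n·eᵢ)`, J. Ginibre, Comm. Math. Phys. **16** (1970) 310).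
* §2 **THE MASSIVE PHASE = THE HIGH-TEMPERATURE PHASE** (Simon–Lieb, sharp, every `K ≥ 0`, every `ν`):
  `hasExponentialDecay_infTwoPoint_iff_summable : HasExponentialDecay G_K ↔ ∑_x G_K(0,x) < ∞`, hence (tree
  `summable_infTwoPoint_iff_ofReal_lt`) `↔ K < K_χ(ν)` (`susceptibilityCriticalCoupling` of
  `PlaneRotatorTransitionCouplings.lean`; `not_hasExponentialDecay_infTwoPoint_of_susceptibilityCriticalCoupling_le`). `⇐` is Simon's Thm 1.3 / Lieb's finite algorithm (tree
  `infTwoPoint_decay_of_summable`) with the explicit rate `hasExponentialDecayRate_infTwoPoint_of_nnBoxShellSum`: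
  **a terminating box `S_R(K) = a < 1` certifies `ξ(K) ≤ R/log(1/a)`**; `⇒` is Simon's lattice sum.
* §3 the object `massGap` (ONE def, through `HasExponentialDecayRate` by name) and its dictionary: `massGap_pos_iff`
  (`0 < massGap ↔ HasExponentialDecay G_K`), `massGap_eq_zero_iff`, `massGap_pos_iff_summable`,
  **`massGap_pos_iff_ofReal_lt : 0 < massGap K ν ↔ K < K_χ(ν)`** — so the correlation-length transition coupling IS
  `K_χ(ν)`, no fourth transition point exists; `massGap_eq_zero_of_susceptibilityCriticalCoupling_le` (`ξ = ∞` at and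
  above `K_χ`, in particular AT the transition, `massGap_toReal_susceptibilityCriticalCoupling`);
  `massGap_antitoneOn` (`ξ` grows with `K`, Griffiths–Ginibre); `massGap_zero` (`= ∞` at `K = 0`);
  Aizenman–Simon's **mass gap above the mean-field-type temperature** `massGap_pos_of_lt_two_mul_criticalBeta`
  (`0 ≤ K < 2β_c(d)`, every `d ≥ 2`; M. Aizenman, B. Simon, Phys. Lett. A **76** (1980) 281 / Comm. Math. Phys. **77**
  (1980) 137, here ON the Ising critical point by sharpness) and `massGap_pos_of_lt_log_one_add_sqrt_two` (`ℤ²`).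
* §4 **CLOSED-FORM WINDOW**: `ofReal_le_massGap_of_nnBoxShellSum` (`log(1/S_R(K))/R ≤ m(K)`),
  `ofReal_le_massGap_of_besselRatio` (`log(1/(2ν·u(K))) ≤ m(K)` on Lieb's star `2ν·u(K) < 1`; the same by name from
  the first box `nnBoxShellSum_one : S_1 = 2ν·I₁/I₀`, `ofReal_le_massGap_of_nnBoxShellSum_one`),
  **`massGap_le_ofReal_neg_log_besselRatio` (`m(K) ≤ log(1/u(K)) = log(I₀(K)/I₁(K))` for EVERY `K > 0`, `ν ≥ 1`)** —
  the correlation length of the comparison model is never zero and is bracketed at high temperature: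
  `1/log(I₀/I₁) ≤ ξ(K) ≤ 1/log(I₀/(2νI₁))`; `massGap_lt_top`.
* §5 `ν = 2`, stiffness and Fröhlich–Spencer: **`massGap_eq_zero_of_torusXYStiffnessLiminf_pos`** (`Υ_∞(K) > 0 ⇒
  ξ(K) = ∞`: a nonzero helicity modulus forces an infinite correlation length, tree
  `not_summable_infTwoPoint_of_torusXYStiffnessLiminf_pos`), `massGap_eq_zero_of_stiffnessCriticalCoupling_lt`,
  `FrohlichSpencerPowerLawLowerBound.massGap_eq_zero` (under the tree's named fact = Theorem C of J. Fröhlich,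
  T. Spencer, Comm. Math. Phys. **81** (1981) 527, hypothesis only: `ξ = ∞` for all `K ≥ K₁`).

* §6 (appended) relation to the tree's AXIS object: `neg_log_infTwoPoint_axis_div_mem_Icc` (the sequence
  `−log G_K(0, n·e₀)/n ∈ [0, log(I₀/I₁)]` is junk-free for `K > 0`), **`massGap_le_ofReal_invCorrLength`**
  (`massGap K ν ≤ invCorrLength G_K`: every `ℓ^∞` rate is an axis rate; `corrLength G_K ≤ ξ(K)` in words),
  `neg_log_le_invCorrLength_of_besselRatio`, `invCorrLength_infTwoPoint_mem_Icc` (`0 ≤ invCorrLength G_K ≤ log(I₀/I₁)`).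

READING for the cell (`pub/hubbard-tc`, MO-S3; §2.4 G2 ∕ §6 №2 ∕ KT-films dictionary; number-neutral): «the
comparison model's correlation length is a typed object: `ξ(K) < ∞` exactly on the high-temperature phase `K < K_χ`
(Simon–Lieb, sharp), `ξ = ∞` at `K_χ` and wherever `Υ_∞ > 0`; so a Kosterlitz–Thouless temperature read from a
diverging `ξ` or `χ` is ONE typed number `T_ξ = T_χ = J/K_χ ≥ T_Υ` — an upper bound for the stiffness transition,
never a lower one; at high temperature `ξ` is bracketed in closed form by Bessel ratios».

NOT CLAIMED (would need the Messager–Miracle-Solé monotonicity for rotators, not in the tree): `ξ(K) → ∞` as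
`K ↑ K_χ`, and the vanishing above `K_χ` of the AXIS mass `invCorrLength` of `CorrelationDecay.lean`; nor `K_χ < ∞`
(Fröhlich–Spencer), nor anything about the Hubbard model. WHAT THIS IS NOT: a value of `ξ` at any coupling of
interest for a material; a statement about `T_KT` of an electron system.
-/

noncomputable section

open MeasureTheory Finset Filter Topology
open scoped BigOperators ENNReal

namespace Literature.Probability.LatticeModels

namespace PlaneRotator

open Literature.Barriers.CriticalPhenomena Literature.Barriers.CriticalPhenomena.LongRangeIsing

variable [MeasurableSpace Circle] [BorelSpace Circle]

/-! ## §1 Pointwise monotonicity in the coupling; Lieb's Theorem 4 and Ginibre's axis floor in infinite volume -/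

section Pointwise

variable {ν : ℕ}

/-- **Griffiths–Ginibre monotonicity in the coupling, pointwise**: `0 ≤ K ≤ K' ⇒ G_K(x, y) ≤ G_{K'}(x, y)`.
[cite: Ginibre1970, Prop. 3 with Example 4 (plane rotators)] -/
theorem infTwoPoint_mono_coupling {K K' : ℝ} (hK : 0 ≤ K) (hKK' : K ≤ K') (x y : Site ν) :
    infTwoPoint K ν x y ≤ infTwoPoint K' ν x y := by
  refine infTwoPoint_le_of_forall_box fun n => le_trans ?_ (volTwoPoint_box_le_infTwoPoint K' n x y)
  by_cases h : x ∈ box ν n ∧ y ∈ box ν n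
  · rw [volTwoPoint_of_mem K h.1 h.2, volTwoPoint_of_mem K' h.1 h.2]
    refine twoPoint_mono (fun p => mul_nonneg (div_nonneg hK zero_le_two) (nnCoupling_nonneg _ _))
      (fun p => ?_) _ _
    unfold nnXYCoupling
    exact mul_le_mul_of_nonneg_right (by linarith) (nnCoupling_nonneg _ _)
  · unfold volTwoPoint
    rw [dif_neg h, dif_neg h]

/-- **Lieb's Theorem 4 in infinite volume**: `G_K(0, x) ≤ (2ν·u(K))^{‖x‖₁}` for `K ≥ 0`, `u = I₁/I₀` — the same
`ℓ¹` rate in every box (`twoPoint_nn_le_pow_besselRatio`) passes to the supremum over boxes.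
[cite: Lieb1980, Theorem 4 (β_c ≥ 0.52 for ν = 2, ≥ 0.34 for ν = 3)] -/
theorem infTwoPoint_le_pow_besselRatio {K : ℝ} (hK : 0 ≤ K) (x : Site ν) :
    infTwoPoint K ν 0 x ≤ (2 * ν * besselRatio K) ^ l1Norm x := by
  refine infTwoPoint_le_of_forall_box fun n => ?_
  by_cases h : (0 : Site ν) ∈ box ν n ∧ x ∈ box ν n
  · rw [volTwoPoint_of_mem K h.1 h.2]
    have h' := twoPoint_nn_le_pow_besselRatio hK (box ν n) ⟨0, h.1⟩ ⟨x, h.2⟩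
    rwa [zero_sub, l1Norm_neg] at h'
  · unfold volTwoPoint
    rw [dif_neg h]
    exact pow_nonneg (mul_nonneg (by positivity) (besselRatio_nonneg hK)) _

omit [MeasurableSpace Circle] [BorelSpace Circle] in
/-- The axis site `k·eᵢ` lies in the box `[−n, n]^ν` for `k ≤ n`. [folklore] -/
private theorem single_natCast_mem_box (i : Fin ν) {k n : ℕ} (hk : k ≤ n) :
    (Pi.single i (k : ℤ) : Site ν) ∈ box ν n := by
  rw [mem_box_iff_supNorm_le, Site.supNorm_le_iff]
  intro j
  by_cases hj : j = i
  · subst hj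
    simpa using hk
  · simp [hj]

omit [MeasurableSpace Circle] [BorelSpace Circle] in
/-- Consecutive axis sites differ by the unit vector: `(k+1)·eᵢ − k·eᵢ = eᵢ`. [folklore] -/
private theorem single_succ_sub_single (i : Fin ν) (k : ℕ) :
    (Pi.single i ((k + 1 : ℕ) : ℤ) : Site ν) - Pi.single i (k : ℤ) = Pi.single i 1 := by
  rw [← Pi.single_sub]
  congr 1
  push_cast
  ring

/-- **Ginibre's path floor along a lattice axis, in infinite volume**: `u(K)^n ≤ G_K(0, n·eᵢ)` for `K ≥ 0` —
the straight chain `0, eᵢ, …, n·eᵢ` inside the box `[−n, n]^ν` carries `n` bonds of strength `K`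
(`pow_besselRatio_le_twoPoint_of_path`), and the box sits below the infinite volume.
[cite: Ginibre1970, Prop. 3 with Example 4 (plane rotators); Lieb1980, eq. (25) (two-spin value I₁/I₀)] -/
theorem pow_besselRatio_le_infTwoPoint_single {K : ℝ} (hK : 0 ≤ K) (i : Fin ν) (n : ℕ) :
    besselRatio K ^ n ≤ infTwoPoint K ν 0 (Pi.single i (n : ℤ)) := by
  classical
  have hmem : ∀ k : Fin (n + 1), (Pi.single i ((k : ℕ) : ℤ) : Site ν) ∈ box ν n :=
    fun k => single_natCast_mem_box i (Nat.lt_succ_iff.1 k.isLt)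
  have h0 : (0 : Site ν) ∈ box ν n := zero_mem_box ν n
  have hn : (Pi.single i (n : ℤ) : Site ν) ∈ box ν n := single_natCast_mem_box i le_rfl
  refine le_trans ?_ (volTwoPoint_box_le_infTwoPoint K n 0 _)
  rw [volTwoPoint_of_mem K h0 hn]
  set τ : Fin (n + 1) → ↥(box ν n) := fun k => ⟨Pi.single i ((k : ℕ) : ℤ), hmem k⟩ with hτ_def
  have hτ : Function.Injective τ := by
    intro k l hkl
    have h := congrArg (fun u : ↥(box ν n) => (u : Site ν) i) hkl
    simp only [hτ_def, Pi.single_eq_same, Nat.cast_inj] at h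
    exact Fin.ext h
  have hJ : ∀ p : ↥(box ν n) × ↥(box ν n), 0 ≤ nnXYCoupling K ν (box ν n) p := fun p =>
    mul_nonneg (div_nonneg hK zero_le_two) (nnCoupling_nonneg _ _)
  have hpath : ∀ k : Fin n, K ≤ nnXYCoupling K ν (box ν n) (τ k.castSucc, τ k.succ) +
      nnXYCoupling K ν (box ν n) (τ k.succ, τ k.castSucc) := by
    intro k
    have hdiff : ((τ k.succ : ↥(box ν n)) : Site ν) - ((τ k.castSucc : ↥(box ν n)) : Site ν) = Pi.single i 1 := by
      simp only [hτ_def, Fin.val_succ, Fin.val_castSucc]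
      exact single_succ_sub_single i k
    have h1 : nnCoupling ν ((τ k.succ : ↥(box ν n)) : Site ν) ((τ k.castSucc : ↥(box ν n)) : Site ν) = 1 := by
      unfold nnCoupling
      rw [hdiff, l1Norm_single, if_pos rfl]
    have h2 : nnCoupling ν ((τ k.castSucc : ↥(box ν n)) : Site ν) ((τ k.succ : ↥(box ν n)) : Site ν) = 1 := by
      unfold nnCoupling
      rw [l1Norm_sub_comm, hdiff, l1Norm_single, if_pos rfl]
    unfold nnXYCoupling
    rw [h1, h2]
    linarith
  have h := pow_besselRatio_le_twoPoint_of_path hJ hτ hK hpath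
  have e0 : τ 0 = ⟨0, h0⟩ := Subtype.ext (by simp [hτ_def])
  have en : τ (Fin.last n) = ⟨Pi.single i (n : ℤ), hn⟩ := Subtype.ext (by simp [hτ_def])
  rwa [e0, en] at h

/-- `G_K(0, x) > 0` along every axis for `K > 0`. [cite: Ginibre1970, Prop. 3 with Example 4 (plane rotators)] -/
theorem infTwoPoint_single_pos {K : ℝ} (hK : 0 < K) (i : Fin ν) (n : ℕ) :
    0 < infTwoPoint K ν 0 (Pi.single i (n : ℤ)) :=
  lt_of_lt_of_le (pow_pos (div_pos (besselI_pos hK 1) (besselI_pos hK 0)) n)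
    (pow_besselRatio_le_infTwoPoint_single hK.le i n)

end Pointwise

/-! ## §2 The massive phase is the high-temperature phase (Simon–Lieb, sharp) -/

section Phase

variable {ν : ℕ}

omit [MeasurableSpace Circle] [BorelSpace Circle] in
/-- A non-negative lattice function with an exponential (`ℓ^∞`-)decay bound is summable (Simon's lattice sum:
`∑_x e^{−m‖x‖_∞} < ∞`). [cite: Simon1980CMP, Thm 1.3 (exponential decay summed over the lattice)] -/
theorem summable_of_hasExponentialDecay_of_nonneg {f : Site ν → ℝ} (hf0 : ∀ x, 0 ≤ f x)
    (h : HasExponentialDecay f) : Summable f := by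
  obtain ⟨C, m, hm, hC⟩ := h
  refine summable_of_le_pow_supNorm_div (R := 1) le_rfl (m := Real.exp (-m)) (C := C) (Real.exp_pos _).le
    (Real.exp_lt_one_iff.2 (by linarith)) hf0 fun x => ?_
  have hx := hC x
  rw [abs_of_nonneg (hf0 x), Site.norm_eq_supNorm] at hx
  rw [Nat.div_one, ← Real.exp_nat_mul, mul_comm (Site.supNorm x : ℝ) (-m)]
  exact hx

/-- **Exponential decay ⇒ finite susceptibility**: if `G_K(0, ·)` decays exponentially (`K ≥ 0`) then
`χ(K) = ∑_x G_K(0, x) < ∞`. [cite: Simon1980CMP, Thm 1.3] -/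
theorem summable_infTwoPoint_of_hasExponentialDecay {K : ℝ} (hK : 0 ≤ K)
    (h : HasExponentialDecay fun x : Site ν => infTwoPoint K ν 0 x) :
    Summable fun x : Site ν => infTwoPoint K ν 0 x :=
  summable_of_hasExponentialDecay_of_nonneg (fun x => infTwoPoint_nonneg hK 0 x) h

omit [MeasurableSpace Circle] [BorelSpace Circle] in
/-- Integer division loses less than one: `s/R − 1 ≤ ⌊s/R⌋` (as reals). [folklore] -/
private theorem div_sub_one_le_natDiv (s : ℕ) {R : ℕ} (hR : 1 ≤ R) :
    (s : ℝ) / R - 1 ≤ ((s / R : ℕ) : ℝ) := by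
  have hRpos : (0 : ℝ) < R := by exact_mod_cast hR
  have hlt : (s : ℝ) < R * (((s / R : ℕ) : ℝ) + 1) := by
    exact_mod_cast Nat.lt_mul_div_succ s (show 0 < R by omega)
  rw [sub_le_iff_le_add, div_le_iff₀ hRpos]
  nlinarith

omit [MeasurableSpace Circle] [BorelSpace Circle] in
/-- Lieb's box decay with a base in `(0, 1)` is an exponential decay bound with an explicit rate:
`a^{⌊s/R⌋} ≤ a⁻¹ · e^{−(log(1/a)/R)·s}`. [folklore] -/
private theorem pow_natDiv_le_inv_mul_exp {a : ℝ} (ha0 : 0 < a) (ha1 : a < 1) {R : ℕ} (hR : 1 ≤ R) (s : ℕ) :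
    a ^ (s / R) ≤ a⁻¹ * Real.exp (-(-Real.log a / R) * (s : ℝ)) := by
  have hq := div_sub_one_le_natDiv s hR
  calc a ^ (s / R) = a ^ ((s / R : ℕ) : ℝ) := (Real.rpow_natCast a _).symm
    _ ≤ a ^ ((s : ℝ) / R - 1) := Real.rpow_le_rpow_of_exponent_ge ha0 ha1.le hq
    _ = a ^ ((s : ℝ) / R) / a := by rw [Real.rpow_sub ha0, Real.rpow_one]
    _ = a⁻¹ * Real.exp (Real.log a * ((s : ℝ) / R)) := by rw [Real.rpow_def_of_pos ha0, div_eq_inv_mul]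
    _ = a⁻¹ * Real.exp (-(-Real.log a / R) * (s : ℝ)) := by
        congr 2
        ring

/-- **A terminating box certifies an exponential decay RATE** (Lieb's bound in infinite volume, quantitative):
if `0 < S_R(K) = a < 1` for some `R ≥ 1` (`K ≥ 0`) then `G_K(0, x) ≤ a^{⌊‖x‖_∞/R⌋} ≤ a⁻¹·e^{−(log(1/a)/R)‖x‖_∞}`,
i.e. `G_K(0, ·)` has `ℓ^∞`-rate `log(1/a)/R` with constant `1/a` — a correlation-length CEILING `ξ(K) ≤ R/log(1/a)`.
[cite: Lieb1980, eq. (23) and p. 128 (φ(β) < 1 for a box ⇒ exponential decay); Simon1980CMP, Thm 1.3] -/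
theorem hasExponentialDecayRate_infTwoPoint_of_nnBoxShellSum {K : ℝ} (hK : 0 ≤ K) {R : ℕ} (hR : 1 ≤ R)
    (ha0 : 0 < nnBoxShellSum K ν R) (ha1 : nnBoxShellSum K ν R < 1) :
    HasExponentialDecayRate (fun x : Site ν => infTwoPoint K ν 0 x) (-Real.log (nnBoxShellSum K ν R) / R) := by
  set a := nnBoxShellSum K ν R with ha_def
  have hlog : Real.log a < 0 := Real.log_neg ha0 ha1
  have hRpos : (0 : ℝ) < R := by exact_mod_cast hR
  refine ⟨div_pos (neg_pos.2 hlog) hRpos, a⁻¹, fun x => ?_⟩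
  rw [abs_of_nonneg (infTwoPoint_nonneg hK 0 x), Site.norm_eq_supNorm]
  have h := infTwoPoint_le_pow_nnBoxShellSum hK hR (0 : Site ν) x
  rw [zero_sub, Site.supNorm_neg] at h
  exact h.trans (pow_natDiv_le_inv_mul_exp ha0 ha1 hR _)

/-- **Finite susceptibility ⇒ exponential decay** (`K ≥ 0`; Simon's Thm 1.3 for plane rotators via Lieb's finite
algorithm, tree `infTwoPoint_decay_of_summable`, in the generic vocabulary `HasExponentialDecay`).
[cite: Simon1980CMP, Thm 1.3 (Σ⟨s₀s_x⟩ < ∞ ⇒ exponential decay); Lieb1980, p. 128] -/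
theorem hasExponentialDecay_infTwoPoint_of_summable {K : ℝ} (hK : 0 ≤ K)
    (hG : Summable fun x : Site ν => infTwoPoint K ν 0 x) :
    HasExponentialDecay fun x : Site ν => infTwoPoint K ν 0 x := by
  obtain ⟨R, hR, a, ha0, ha1, hxy⟩ := infTwoPoint_decay_of_summable hK hG
  -- replace `a` by `b = max a ½ ∈ [½, 1)` so that the rate is a genuine logarithm
  set b := max a (1 / 2) with hb_def
  have hb0 : 0 < b := lt_of_lt_of_le one_half_pos (le_max_right _ _)
  have hb1 : b < 1 := max_lt ha1 one_half_lt_one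
  have hlog : Real.log b < 0 := Real.log_neg hb0 hb1
  have hRpos : (0 : ℝ) < R := by exact_mod_cast hR
  refine ⟨b⁻¹, -Real.log b / R, div_pos (neg_pos.2 hlog) hRpos, fun x => ?_⟩
  rw [abs_of_nonneg (infTwoPoint_nonneg hK 0 x), Site.norm_eq_supNorm]
  have h := hxy (0 : Site ν) x
  rw [zero_sub, Site.supNorm_neg] at h
  calc infTwoPoint K ν 0 x ≤ a ^ (Site.supNorm x / R) := h
    _ ≤ b ^ (Site.supNorm x / R) := pow_le_pow_left₀ ha0 (le_max_left _ _) _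
    _ ≤ b⁻¹ * Real.exp (-(-Real.log b / R) * (Site.supNorm x : ℝ)) := pow_natDiv_le_inv_mul_exp hb0 hb1 hR _

/-- **THE MASSIVE PHASE IS THE HIGH-TEMPERATURE PHASE** (`K ≥ 0`, every `ν`): `G_K(0, ·)` decays exponentially iff
`χ(K) < ∞`. [cite: Simon1980CMP, Thm 1.3; Lieb1980, p. 128 (boxes)] -/
theorem hasExponentialDecay_infTwoPoint_iff_summable {K : ℝ} (hK : 0 ≤ K) :
    (HasExponentialDecay fun x : Site ν => infTwoPoint K ν 0 x) ↔ Summable fun x : Site ν => infTwoPoint K ν 0 x :=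
  ⟨summable_infTwoPoint_of_hasExponentialDecay hK, hasExponentialDecay_infTwoPoint_of_summable hK⟩

/-- Above the susceptibility transition there is no exponential clustering: `K_χ(ν) ≤ K ⇒ ¬ HasExponentialDecay G_K`
(in particular AT `K = K_χ` when it is finite). [cite: Simon1980CMP, Thm 1.3; Lieb1980, Theorem 4 and p. 128] -/
theorem not_hasExponentialDecay_infTwoPoint_of_susceptibilityCriticalCoupling_le {K : ℝ} (hK : 0 ≤ K)
    (h : susceptibilityCriticalCoupling ν ≤ ENNReal.ofReal K) :
    ¬ HasExponentialDecay fun x : Site ν => infTwoPoint K ν 0 x := fun hd =>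
  absurd ((summable_infTwoPoint_iff_ofReal_lt hK).1 ((hasExponentialDecay_infTwoPoint_iff_summable hK).1 hd))
    (not_lt.2 h)

end Phase

/-! ## §3 The mass gap `m(K) = 1/ξ(K)` as an extended non-negative real -/

section MassGap

variable {ν : ℕ}

/-- **The mass gap (inverse correlation length) of the plane rotator on `ℤ^ν` at reduced coupling `K`**:
`massGap K ν := sup {m : ∃ C, ∀ x, |G_K(0, x)| ≤ C·e^{−m‖x‖_∞}} ∈ [0, ∞]`, the supremum of the `ℓ^∞`-decay rates of
the infinite-volume two-point function (`HasExponentialDecayRate` of `CorrelationDecay.lean`); the correlation length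
is `ξ(K) = 1/massGap K ν` (`massGap = 0` reads `ξ = ∞`, `massGap = ∞` reads `ξ = 0`). This is NOT the tree's axis
object `invCorrLength`/`corrLength` of `CorrelationDecay.lean` (a real `liminf` of `−log G(n·e₀)/n` along one axis,
Friedli–Velenik §3.10.7): `massGap` is the direction-free `ℓ^∞` rate with a constant, so that `massGap > 0` is
literally `HasExponentialDecay` (`massGap_pos_iff`) and needs no Messager–Miracle-Solé input; for `K > 0` every
`ℓ^∞` rate is at most the axis rate, so informally `massGap ≤ invCorrLength` (not formalised here).
[cite: FriedliVelenik2017, §3.7.4 eq. (3.68) and §3.10.7 (correlation length); Simon1980CMP, Thm 1.3 (mass gap)] -/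
def massGap (K : ℝ) (ν : ℕ) : ℝ≥0∞ :=
  ⨆ (m : ℝ) (_ : HasExponentialDecayRate (fun x : Site ν => infTwoPoint K ν 0 x) m), ENNReal.ofReal m

/-- Every decay rate lies below the mass gap. [cite: FriedliVelenik2017, §3.7.4] -/
theorem ofReal_le_massGap {K m : ℝ}
    (h : HasExponentialDecayRate (fun x : Site ν => infTwoPoint K ν 0 x) m) :
    ENNReal.ofReal m ≤ massGap K ν :=
  le_iSup_of_le (f := fun m : ℝ => ⨆ (_ : HasExponentialDecayRate (fun x : Site ν => infTwoPoint K ν 0 x) m),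
    ENNReal.ofReal m) m (le_iSup (fun _ : HasExponentialDecayRate (fun x : Site ν => infTwoPoint K ν 0 x) m =>
      ENNReal.ofReal m) h)

/-- The mass gap is bounded by `c` as soon as every decay rate is. [cite: FriedliVelenik2017, §3.7.4] -/
theorem massGap_le_ofReal_of_forall_le {K c : ℝ}
    (h : ∀ m, HasExponentialDecayRate (fun x : Site ν => infTwoPoint K ν 0 x) m → m ≤ c) :
    massGap K ν ≤ ENNReal.ofReal c :=
  iSup₂_le fun m hm => ENNReal.ofReal_le_ofReal (h m hm)

/-- **`m(K) > 0 ⇔` exponential clustering.** [cite: FriedliVelenik2017, §3.7.4 eq. (3.68)] -/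
theorem massGap_pos_iff {K : ℝ} :
    0 < massGap K ν ↔ HasExponentialDecay fun x : Site ν => infTwoPoint K ν 0 x := by
  constructor
  · intro h
    obtain ⟨m, hm⟩ := lt_iSup_iff.1 h
    obtain ⟨hrate, _⟩ := lt_iSup_iff.1 hm
    exact hrate.hasExponentialDecay
  · rintro ⟨C, m, hm, hC⟩
    exact lt_of_lt_of_le (ENNReal.ofReal_pos.2 hm) (ofReal_le_massGap ⟨hm, C, hC⟩)

/-- **`m(K) = 0 ⇔` no exponential clustering** (`ξ = ∞`). [cite: FriedliVelenik2017, §3.7.4 eq. (3.68)] -/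
theorem massGap_eq_zero_iff {K : ℝ} :
    massGap K ν = 0 ↔ ¬ HasExponentialDecay fun x : Site ν => infTwoPoint K ν 0 x := by
  rw [← massGap_pos_iff, not_lt, nonpos_iff_eq_zero]

/-- **`m(K) > 0 ⇔ χ(K) < ∞`** (`K ≥ 0`). [cite: Simon1980CMP, Thm 1.3; Lieb1980, p. 128] -/
theorem massGap_pos_iff_summable {K : ℝ} (hK : 0 ≤ K) :
    0 < massGap K ν ↔ Summable fun x : Site ν => infTwoPoint K ν 0 x :=
  massGap_pos_iff.trans (hasExponentialDecay_infTwoPoint_iff_summable hK)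

/-- **`m(K) > 0 ⇔ K < K_χ(ν)`** (`K ≥ 0`): the correlation length is finite exactly on the high-temperature phase —
`T_ξ = T_χ` as typed numbers. [cite: Simon1980CMP, Thm 1.3; Lieb1980, p. 128 (boxes)] -/
theorem massGap_pos_iff_ofReal_lt {K : ℝ} (hK : 0 ≤ K) :
    0 < massGap K ν ↔ ENNReal.ofReal K < susceptibilityCriticalCoupling ν :=
  (massGap_pos_iff_summable hK).trans (summable_infTwoPoint_iff_ofReal_lt hK)

/-- `m(K) = 0 ⇔ χ(K) = ∞` (`K ≥ 0`). [cite: Simon1980CMP, Thm 1.3] -/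
theorem massGap_eq_zero_iff_not_summable {K : ℝ} (hK : 0 ≤ K) :
    massGap K ν = 0 ↔ ¬ Summable fun x : Site ν => infTwoPoint K ν 0 x := by
  rw [← massGap_pos_iff_summable hK, not_lt, nonpos_iff_eq_zero]

/-- **`ξ = ∞` at and above the susceptibility transition**: `0 ≤ K`, `K_χ(ν) ≤ K ⇒ m(K) = 0`.
[cite: Simon1980CMP, Thm 1.3; Lieb1980, Theorem 4 and p. 128 (β ≥ β_c ⇒ no box terminates)] -/
theorem massGap_eq_zero_of_susceptibilityCriticalCoupling_le {K : ℝ} (hK : 0 ≤ K)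
    (h : susceptibilityCriticalCoupling ν ≤ ENNReal.ofReal K) : massGap K ν = 0 := by
  by_contra hne
  exact absurd ((massGap_pos_iff_ofReal_lt hK).1 (pos_iff_ne_zero.2 hne)) (not_lt.2 h)

/-- **At the transition coupling itself the correlation length is infinite** (when `K_χ(ν) < ∞`): `m(K_χ) = 0`.
[cite: Simon1980CMP, Thm 1.3; Lieb1980, Theorem 4 and p. 128] -/
theorem massGap_toReal_susceptibilityCriticalCoupling (h : susceptibilityCriticalCoupling ν ≠ ⊤) :
    massGap (susceptibilityCriticalCoupling ν).toReal ν = 0 :=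
  massGap_eq_zero_of_susceptibilityCriticalCoupling_le ENNReal.toReal_nonneg (ENNReal.ofReal_toReal h).ge

/-- Below the transition the mass gap is positive: `0 ≤ K`, `K < K_χ(ν) ⇒ 0 < m(K)`.
[cite: Simon1980CMP, Thm 1.3; Lieb1980, p. 128] -/
theorem massGap_pos_of_ofReal_lt {K : ℝ} (hK : 0 ≤ K) (h : ENNReal.ofReal K < susceptibilityCriticalCoupling ν) :
    0 < massGap K ν :=
  (massGap_pos_iff_ofReal_lt hK).2 h

/-- **The correlation length grows with the coupling** (Griffiths–Ginibre): `K ↦ m(K)` is antitone on `[0, ∞)` —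
every decay bound of `G_{K'}` is one of `G_K ≤ G_{K'}` for `0 ≤ K ≤ K'`.
[cite: Ginibre1970, Prop. 3 with Example 4 (plane rotators)] -/
theorem massGap_antitoneOn : AntitoneOn (fun K => massGap K ν) (Set.Ici 0) := by
  intro K hK K' _ hKK'
  show massGap K' ν ≤ massGap K ν
  refine iSup₂_le fun m hm => ofReal_le_massGap ?_
  obtain ⟨hm0, C, hC⟩ := hm
  exact ⟨hm0, C, fun x => (abs_le_abs_of_nonneg (infTwoPoint_nonneg hK 0 x)
    (infTwoPoint_mono_coupling hK hKK' 0 x)).trans (hC x)⟩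

omit [MeasurableSpace Circle] [BorelSpace Circle] in
/-- `‖x‖₁ = 0 ↔ x = 0` on `ℤ^ν`. [folklore] -/
private theorem l1Norm_eq_zero_iff' {x : Site ν} : l1Norm x = 0 ↔ x = 0 := by
  constructor
  · intro h
    funext i
    have hi := (Finset.sum_eq_zero_iff.1 h) i (Finset.mem_univ i)
    simpa using hi
  · rintro rfl
    simp [l1Norm]

/-- **At infinite temperature the correlation length is zero**: `m(0) = ∞` (`G_0(0, x) = 0` for `x ≠ 0`, Lieb's rate
`(2ν·u(0))^{‖x‖₁} = 0`). [cite: Lieb1980, Theorem 4] -/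
theorem massGap_zero : massGap 0 ν = ⊤ := by
  refine ENNReal.eq_top_of_forall_nnreal_le fun r => ?_
  have hrate : HasExponentialDecayRate (fun x : Site ν => infTwoPoint 0 ν 0 x) ((r : ℝ) + 1) := by
    refine ⟨by positivity, 1, fun x => ?_⟩
    rw [abs_of_nonneg (infTwoPoint_nonneg le_rfl 0 x), one_mul]
    by_cases hx : x = 0
    · subst hx
      rw [norm_zero, mul_zero, Real.exp_zero]
      exact infTwoPoint_le_one 0 0 0
    · have h := infTwoPoint_le_pow_besselRatio (ν := ν) le_rfl x
      rw [besselRatio_zero, mul_zero, zero_pow (fun h0 => hx (l1Norm_eq_zero_iff'.1 h0))] at h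
      exact h.trans (Real.exp_pos _).le
  calc (r : ℝ≥0∞) = ENNReal.ofReal r := ENNReal.ofReal_coe_nnreal.symm
    _ ≤ ENNReal.ofReal ((r : ℝ) + 1) := ENNReal.ofReal_le_ofReal (by linarith)
    _ ≤ massGap 0 ν := ofReal_le_massGap hrate

/-- **Aizenman–Simon: a mass gap above the mean-field-type temperature, in every dimension** — for the plane rotator
on `ℤ^d`, `d ≥ 2`, `0 ≤ K < 2β_c(d)` (`β_c(d)` the Ising critical point; on it by the proved sharpness of the Ising
transition): `m(K) > 0`. [cite: AizenmanSimon1980LocalWard, abstract and Thm 3 («a mass gap above the mean field temperature, for all N ≥ 2»); AizenmanSimon1980RotorIsing, eqs. (1)–(2); Simon1980CMP, Thm 1.3] -/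
theorem massGap_pos_of_lt_two_mul_criticalBeta {d : ℕ} (hd : 2 ≤ d) {K : ℝ} (hK0 : 0 ≤ K)
    (hK : K < 2 * criticalBeta d) : 0 < massGap K d :=
  (massGap_pos_iff_summable hK0).2 (summable_infTwoPoint_of_lt_two_mul_criticalBeta hd hK0 hK)

/-- `ℤ²`: a mass gap throughout the Aizenman–Simon–Onsager window `0 ≤ K < log(1+√2)`.
[cite: AizenmanSimon1980RotorIsing, eq. (2); Simon1980CMP, Thm 1.3] -/
theorem massGap_pos_of_lt_log_one_add_sqrt_two {K : ℝ} (hK0 : 0 ≤ K) (hK : K < Real.log (1 + Real.sqrt 2)) :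
    0 < massGap K 2 :=
  (massGap_pos_iff_summable hK0).2 (summable_infTwoPoint_of_lt_log_one_add_sqrt_two hK0 hK)

end MassGap

/-! ## §4 Closed-form window for the mass gap: certificates from boxes, the star, and Ginibre's axis floor -/

section Window

variable {ν : ℕ}

/-- **A terminating box certifies a correlation-length ceiling**: `0 < S_R(K) = a < 1`, `R ≥ 1`, `K ≥ 0` ⇒
`log(1/a)/R ≤ m(K)`, i.e. `ξ(K) ≤ R/log(1/a)`. [cite: Lieb1980, eq. (23) and p. 128 (boxes; finite algorithm); Simon1980CMP, Thm 1.3] -/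
theorem ofReal_le_massGap_of_nnBoxShellSum {K : ℝ} (hK : 0 ≤ K) {R : ℕ} (hR : 1 ≤ R)
    (ha0 : 0 < nnBoxShellSum K ν R) (ha1 : nnBoxShellSum K ν R < 1) :
    ENNReal.ofReal (-Real.log (nnBoxShellSum K ν R) / R) ≤ massGap K ν :=
  ofReal_le_massGap (hasExponentialDecayRate_infTwoPoint_of_nnBoxShellSum hK hR ha0 ha1)

/-- **Lieb's star as a rate**: if `0 < 2ν·u(K) < 1` (`K ≥ 0`, `u = I₁/I₀`) then `G_K(0, ·)` has `ℓ^∞`-rate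
`log(1/(2ν·u(K)))` with constant `1` (`(2νu)^{‖x‖₁} ≤ (2νu)^{‖x‖_∞}`). [cite: Lieb1980, Theorem 4 (S_1 = 2ν I₁/I₀; β_c ≥ 0.52 for ν = 2)] -/
theorem hasExponentialDecayRate_infTwoPoint_of_besselRatio {K : ℝ} (hK : 0 ≤ K)
    (hb0 : 0 < 2 * ν * besselRatio K) (hb1 : 2 * ν * besselRatio K < 1) :
    HasExponentialDecayRate (fun x : Site ν => infTwoPoint K ν 0 x) (-Real.log (2 * ν * besselRatio K)) := by
  set b := 2 * (ν : ℝ) * besselRatio K with hb_def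
  have hlog : Real.log b < 0 := Real.log_neg hb0 hb1
  refine ⟨neg_pos.2 hlog, 1, fun x => ?_⟩
  rw [abs_of_nonneg (infTwoPoint_nonneg hK 0 x), one_mul, Site.norm_eq_supNorm]
  have hsup : Site.supNorm x ≤ l1Norm x := by
    unfold Site.supNorm l1Norm
    refine Finset.sup_le fun i _ => ?_
    exact Finset.single_le_sum (f := fun i => (x i).natAbs) (fun _ _ => Nat.zero_le _) (Finset.mem_univ i)
  calc infTwoPoint K ν 0 x ≤ b ^ l1Norm x := infTwoPoint_le_pow_besselRatio hK x
    _ ≤ b ^ Site.supNorm x := pow_le_pow_of_le_one hb0.le hb1.le hsup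
    _ = Real.exp (-(-Real.log b) * (Site.supNorm x : ℝ)) := by
        rw [neg_neg, ← Real.rpow_natCast, Real.rpow_def_of_pos hb0]

/-- **Star certificate for the correlation length**: `0 < 2ν·u(K) < 1` ⇒ `log(1/(2ν·u(K))) ≤ m(K)`, i.e.
`ξ(K) ≤ 1/log(I₀(K)/(2ν·I₁(K)))` — on `ℤ²` throughout Lieb's phase `4u(K) < 1`.
[cite: Lieb1980, Theorem 4 (β_c ≥ 0.52 for ν = 2, ≥ 0.34 for ν = 3)] -/
theorem ofReal_le_massGap_of_besselRatio {K : ℝ} (hK : 0 ≤ K)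
    (hb0 : 0 < 2 * ν * besselRatio K) (hb1 : 2 * ν * besselRatio K < 1) :
    ENNReal.ofReal (-Real.log (2 * ν * besselRatio K)) ≤ massGap K ν :=
  ofReal_le_massGap (hasExponentialDecayRate_infTwoPoint_of_besselRatio hK hb0 hb1)

/-- The same star certificate obtained from the general box certificate at `R = 1` by name
(`nnBoxShellSum_one : S_1(K) = 2ν·I₁(K)/I₀(K)`): `0 < 2ν·I₁/I₀ < 1 ⇒ log(I₀/(2ν·I₁)) ≤ m(K)`.
[cite: Lieb1980, Theorem 4 (the first box is the star: S_1 = 2ν I₁/I₀)] -/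
theorem ofReal_le_massGap_of_nnBoxShellSum_one {K : ℝ} (hK : 0 ≤ K)
    (hb0 : 0 < 2 * ν * (besselI 1 K / besselI 0 K)) (hb1 : 2 * ν * (besselI 1 K / besselI 0 K) < 1) :
    ENNReal.ofReal (-Real.log (2 * ν * (besselI 1 K / besselI 0 K))) ≤ massGap K ν := by
  have h0 : 0 < nnBoxShellSum K ν 1 := by rw [nnBoxShellSum_one]; exact hb0
  have h1 : nnBoxShellSum K ν 1 < 1 := by rw [nnBoxShellSum_one]; exact hb1
  have h := ofReal_le_massGap_of_nnBoxShellSum hK le_rfl h0 h1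
  rwa [nnBoxShellSum_one, Nat.cast_one, div_one] at h

/-- **The correlation length is never zero at positive coupling** (Ginibre's axis floor): for `K > 0` and `ν ≥ 1`
every `ℓ^∞`-decay rate `m` of `G_K(0, ·)` satisfies `m ≤ log(1/u(K)) = log(I₀(K)/I₁(K))` — since
`u(K)^n ≤ G_K(0, n·e₀) ≤ C·e^{−mn}` for all `n` forces `u(K)·e^m ≤ 1`. Hence `m(K) ≤ log(I₀/I₁)`,
`ξ(K) ≥ 1/log(I₀(K)/I₁(K)) > 0`. [cite: Ginibre1970, Prop. 3 with Example 4 (plane rotators); Lieb1980, eq. (25)] -/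
theorem massGap_le_ofReal_neg_log_besselRatio (hν : 0 < ν) {K : ℝ} (hK : 0 < K) :
    massGap K ν ≤ ENNReal.ofReal (-Real.log (besselRatio K)) := by
  have i : Fin ν := ⟨0, hν⟩
  have hu0 : 0 < besselRatio K := div_pos (besselI_pos hK 1) (besselI_pos hK 0)
  refine massGap_le_ofReal_of_forall_le fun m hm => ?_
  obtain ⟨_, C, hC⟩ := hm
  have hn : ∀ n : ℕ, (besselRatio K * Real.exp m) ^ n ≤ C := by
    intro n
    have h1 := pow_besselRatio_le_infTwoPoint_single (ν := ν) hK.le i n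
    have h2 := hC (Pi.single i (n : ℤ))
    rw [abs_of_nonneg (infTwoPoint_nonneg hK.le 0 _), Pi.norm_single, Int.norm_natCast] at h2
    have h12 : besselRatio K ^ n ≤ C * Real.exp (-m * n) := h1.trans h2
    calc (besselRatio K * Real.exp m) ^ n = besselRatio K ^ n * Real.exp (n * m) := by
          rw [mul_pow, ← Real.exp_nat_mul]
      _ ≤ C * Real.exp (-m * n) * Real.exp (n * m) := mul_le_mul_of_nonneg_right h12 (Real.exp_pos _).le
      _ = C := by
          rw [mul_assoc, ← Real.exp_add, show -m * (n : ℝ) + n * m = 0 by ring, Real.exp_zero, mul_one]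
  refine le_of_not_gt fun hlt => ?_
  have hgt : 1 < besselRatio K * Real.exp m := by
    have hpos : 0 < Real.log (besselRatio K) + m := by linarith
    calc (1 : ℝ) < Real.exp (Real.log (besselRatio K) + m) := Real.one_lt_exp_iff.2 hpos
      _ = besselRatio K * Real.exp m := by rw [Real.exp_add, Real.exp_log hu0]
  obtain ⟨n, hn'⟩ := ((tendsto_pow_atTop_atTop_of_one_lt hgt).eventually (eventually_gt_atTop C)).exists
  exact absurd (hn n) (not_le.2 hn')

/-- The mass gap is finite at every positive coupling (`ν ≥ 1`): `m(K) < ∞`, `ξ(K) > 0`.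
[cite: Ginibre1970, Prop. 3 with Example 4 (plane rotators)] -/
theorem massGap_lt_top (hν : 0 < ν) {K : ℝ} (hK : 0 < K) : massGap K ν < ⊤ :=
  lt_of_le_of_lt (massGap_le_ofReal_neg_log_besselRatio hν hK) ENNReal.ofReal_lt_top

/-- **Two-sided closed-form window at high temperature**: for `K > 0` with `2ν·u(K) < 1` (`ν ≥ 1`),
`log(I₀/(2ν·I₁)) ≤ m(K) ≤ log(I₀/I₁)` — equivalently `1/log(I₀(K)/I₁(K)) ≤ ξ(K) ≤ 1/log(I₀(K)/(2ν·I₁(K)))`;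
the two sides differ by the additive constant `log(2ν)` in `1/ξ`, so the ratio tends to `1` as `K → 0`.
[cite: Lieb1980, Theorem 4; Ginibre1970, Prop. 3 with Example 4 (plane rotators)] -/
theorem massGap_mem_Icc_of_besselRatio (hν : 0 < ν) {K : ℝ} (hK : 0 < K) (hb1 : 2 * ν * besselRatio K < 1) :
    massGap K ν ∈ Set.Icc (ENNReal.ofReal (-Real.log (2 * ν * besselRatio K)))
      (ENNReal.ofReal (-Real.log (besselRatio K))) := by
  have hu0 : 0 < besselRatio K := div_pos (besselI_pos hK 1) (besselI_pos hK 0)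
  have hν' : (0 : ℝ) < ν := by exact_mod_cast hν
  exact ⟨ofReal_le_massGap_of_besselRatio hK.le (by positivity) hb1, massGap_le_ofReal_neg_log_besselRatio hν hK⟩

end Window

/-! ## §5 `ℤ²`: the stiffness and Fröhlich–Spencer's Theorem C force an infinite correlation length -/

section Square

/-- **A nonzero helicity modulus forces an infinite correlation length**: `0 ≤ K`, `Υ_∞(K) > 0 ⇒ m(K) = 0`
(`Υ_∞ > 0 ⇒ χ = ∞`, tree `not_summable_infTwoPoint_of_torusXYStiffnessLiminf_pos`, Simon–Lieb). So the stiffness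
transition of the 2D XY model lies at or below the divergence of the correlation length: `T_Υ ≤ T_ξ = T_χ`.
[cite: Simon1980CMP, Thm 1.3; Lieb1980, Theorem 4 and p. 128; FisherBarberJasnow1973, §II eq. (2.5) (Υ)] -/
theorem massGap_eq_zero_of_torusXYStiffnessLiminf_pos {K : ℝ} (hK : 0 ≤ K) (h : 0 < torusXYStiffnessLiminf K) :
    massGap K 2 = 0 :=
  (massGap_eq_zero_iff_not_summable hK).2 (not_summable_infTwoPoint_of_torusXYStiffnessLiminf_pos hK h)

/-- In transition-coupling form: `0 ≤ K`, `K_Υ < K ⇒ m(K) = 0` (`K_χ(2) ≤ K_Υ`,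
`susceptibilityCriticalCoupling_two_le_stiffnessCriticalCoupling`). [cite: Simon1980CMP, Thm 1.3; FisherBarberJasnow1973, §II eq. (2.5)] -/
theorem massGap_eq_zero_of_stiffnessCriticalCoupling_lt {K : ℝ} (hK : 0 ≤ K)
    (h : stiffnessCriticalCoupling < ENNReal.ofReal K) : massGap K 2 = 0 :=
  massGap_eq_zero_of_susceptibilityCriticalCoupling_le hK
    (susceptibilityCriticalCoupling_two_le_stiffnessCriticalCoupling.trans h.le)

/-- **Under Fröhlich–Spencer's Theorem C** (the tree's named fact `FrohlichSpencerPowerLawLowerBound`, hypothesis):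
there is `K₁ > 0` with `m(K) = 0`, i.e. `ξ(K) = ∞`, for every `K ≥ K₁` — the Kosterlitz–Thouless phase has infinite
correlation length. [cite: FrohlichSpencerKT1981, §1.4 Theorem C (p. 534); Simon1980CMP, Thm 1.3] -/
theorem FrohlichSpencerPowerLawLowerBound.massGap_eq_zero (hFS : FrohlichSpencerPowerLawLowerBound) :
    ∃ K₁ : ℝ, 0 < K₁ ∧ ∀ K : ℝ, K₁ ≤ K → massGap K 2 = 0 := by
  obtain ⟨K₁, hK₁, h⟩ := hFS.not_summable
  exact ⟨K₁, hK₁, fun K hK => (massGap_eq_zero_iff_not_summable (hK₁.le.trans hK)).2 (h K hK)⟩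

/-- `ℤ²`, closed form: for `0 < K` with `4u(K) < 1`, `log(1/(4u(K))) ≤ m(K) ≤ log(1/u(K))`.
[cite: Lieb1980, Theorem 4 (ν = 2: β_c ≥ 0.52); Ginibre1970, Prop. 3 with Example 4 (plane rotators)] -/
theorem massGap_two_mem_Icc {K : ℝ} (hK : 0 < K) (h4 : 4 * besselRatio K < 1) :
    massGap K 2 ∈ Set.Icc (ENNReal.ofReal (-Real.log (4 * besselRatio K)))
      (ENNReal.ofReal (-Real.log (besselRatio K))) := by
  have h := massGap_mem_Icc_of_besselRatio (ν := 2) two_pos hK (by push_cast; linarith)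
  norm_num at h
  exact h

end Square

/-! ## §6 Relation to the tree's axis correlation length `invCorrLength` -/

section Axis

variable {ν : ℕ}

omit [MeasurableSpace Circle] [BorelSpace Circle] in
/-- The axis site of `invCorrLength`, `n • e₀`, is `Pi.single 0 n`. [folklore] -/
private theorem natCast_zsmul_single_one [NeZero ν] (n : ℕ) :
    ((n : ℤ) • Pi.single (0 : Fin ν) (1 : ℤ) : Site ν) = Pi.single 0 (n : ℤ) := by
  rw [← Pi.single_smul, smul_eq_mul, mul_one]

/-- Along the axis the sequence `−log G_K(0, n·e₀)/n` is squeezed: `0 ≤ −log G_K(0, n·e₀)/n ≤ log(1/u(K))` for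
`K > 0` (`G ≤ 1` and Ginibre's axis floor `u(K)^n ≤ G_K(0, n·e₀)`).
[cite: Ginibre1970, Prop. 3 with Example 4 (plane rotators); Lieb1980, eq. (25)] -/
theorem neg_log_infTwoPoint_axis_div_mem_Icc [NeZero ν] {K : ℝ} (hK : 0 < K) (n : ℕ) :
    -Real.log |infTwoPoint K ν 0 ((n : ℤ) • Pi.single (0 : Fin ν) (1 : ℤ))| / n ∈
      Set.Icc 0 (-Real.log (besselRatio K)) := by
  rw [natCast_zsmul_single_one, abs_of_nonneg (infTwoPoint_nonneg hK.le 0 _)]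
  have hu0 : 0 < besselRatio K := div_pos (besselI_pos hK 1) (besselI_pos hK 0)
  have hfloor := pow_besselRatio_le_infTwoPoint_single (ν := ν) hK.le 0 n
  have hpos : 0 < infTwoPoint K ν 0 (Pi.single 0 (n : ℤ)) := lt_of_lt_of_le (pow_pos hu0 n) hfloor
  have hle1 : infTwoPoint K ν 0 (Pi.single 0 (n : ℤ)) ≤ 1 := infTwoPoint_le_one K 0 _
  rcases Nat.eq_zero_or_pos n with hn | hn
  · subst hn
    simp only [Nat.cast_zero, div_zero, Set.left_mem_Icc]
    exact neg_nonneg.2 (Real.log_nonpos hu0.le (besselRatio_lt_one hK.le).le)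
  have hn' : (0 : ℝ) < n := by exact_mod_cast hn
  constructor
  · exact div_nonneg (neg_nonneg.2 (Real.log_nonpos hpos.le hle1)) hn'.le
  · rw [div_le_iff₀ hn']
    have h := Real.log_le_log (pow_pos hu0 n) hfloor
    rw [Real.log_pow] at h
    linarith

/-- **Every `ℓ^∞` decay rate is an axis rate: `massGap K ν ≤ invCorrLength G_K`** (`K > 0`, `ν ≥ 1`): a bound
`G_K(0, x) ≤ C·e^{−m‖x‖_∞}` gives `−log G_K(0, n·e₀)/n ≥ m − log C/n`, whose `liminf` is at least `m`; the logarithms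
are junk-free by Ginibre's axis floor. In words: the tree's axis correlation length `corrLength G_K` is at most
`ξ(K) = 1/massGap` (this is the inequality announced informally in the docstring of `massGap`; the converse would need
the Messager–Miracle-Solé monotonicity for rotators and is not claimed). [cite: FriedliVelenik2017, §3.10.7 (correlation length along an axis); Ginibre1970, Prop. 3 with Example 4] -/
theorem massGap_le_ofReal_invCorrLength [NeZero ν] {K : ℝ} (hK : 0 < K) :
    massGap K ν ≤ ENNReal.ofReal (invCorrLength fun x : Site ν => infTwoPoint K ν 0 x) := by
  refine massGap_le_ofReal_of_forall_le fun m hm => ?_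
  obtain ⟨_, C, hC⟩ := hm
  -- the constant of the decay bound is positive (the two-point function is positive on the axis)
  have hC0 : 0 < C := by
    have h1 := hC (Pi.single 0 ((1 : ℕ) : ℤ))
    have hpos := infTwoPoint_single_pos (ν := ν) hK 0 1
    rw [abs_of_nonneg hpos.le] at h1
    by_contra hle
    have : C * Real.exp (-m * ‖(Pi.single 0 ((1 : ℕ) : ℤ) : Site ν)‖) ≤ 0 :=
      mul_nonpos_of_nonpos_of_nonneg (le_of_not_gt hle) (Real.exp_pos _).le
    linarith
  -- pointwise lower bound `−log G(n e₀)/n ≥ m − log C / n` for `n ≥ 1`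
  have hpt : ∀ n : ℕ, 0 < n → m - Real.log C / n ≤
      -Real.log |infTwoPoint K ν 0 ((n : ℤ) • Pi.single (0 : Fin ν) (1 : ℤ))| / n := by
    intro n hn
    have hn' : (0 : ℝ) < n := by exact_mod_cast hn
    have hx := hC ((n : ℤ) • Pi.single (0 : Fin ν) (1 : ℤ))
    have hpos : 0 < |infTwoPoint K ν 0 ((n : ℤ) • Pi.single (0 : Fin ν) (1 : ℤ))| := by
      rw [natCast_zsmul_single_one, abs_of_nonneg (infTwoPoint_nonneg hK.le 0 _)]
      exact infTwoPoint_single_pos hK 0 n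
    have hnorm : ‖((n : ℤ) • Pi.single (0 : Fin ν) (1 : ℤ) : Site ν)‖ = n := by
      rw [natCast_zsmul_single_one, Pi.norm_single, Int.norm_natCast]
    rw [hnorm] at hx
    have hlog := Real.log_le_log hpos hx
    rw [Real.log_mul hC0.ne' (Real.exp_pos _).ne', Real.log_exp] at hlog
    rw [le_div_iff₀ hn', sub_mul, div_mul_cancel₀ _ hn'.ne']
    linarith
  have htend : Tendsto (fun n : ℕ => m - Real.log C / n) atTop (𝓝 m) := by
    simpa using (tendsto_const_nhds (x := m)).sub (tendsto_const_div_atTop_nhds_zero_nat (Real.log C))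
  have hbbdd : IsBoundedUnder (· ≥ ·) atTop (fun n : ℕ => m - Real.log C / n) := by
    refine isBoundedUnder_of ⟨m - |Real.log C|, fun n => ?_⟩
    have h : Real.log C / n ≤ |Real.log C| := by
      rcases Nat.eq_zero_or_pos n with hn | hn
      · subst hn
        simp
      · have hn' : (1 : ℝ) ≤ n := by exact_mod_cast hn
        exact (le_abs_self _).trans ((abs_div _ _).trans_le
          (by rw [abs_of_pos (by linarith : (0 : ℝ) < n)]; exact div_le_self (abs_nonneg _) hn'))
    show m - |Real.log C| ≤ m - Real.log C / n
    linarith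
  have hbdd : IsBoundedUnder (· ≤ ·) atTop
      (fun n : ℕ => -Real.log |infTwoPoint K ν 0 ((n : ℤ) • Pi.single (0 : Fin ν) (1 : ℤ))| / n) :=
    isBoundedUnder_of ⟨-Real.log (besselRatio K), fun n => (neg_log_infTwoPoint_axis_div_mem_Icc hK n).2⟩
  have hev : ∀ᶠ n : ℕ in atTop, m - Real.log C / n ≤
      -Real.log |infTwoPoint K ν 0 ((n : ℤ) • Pi.single (0 : Fin ν) (1 : ℤ))| / n :=
    (eventually_gt_atTop 0).mono hpt
  have key : m ≤ liminf
      (fun n : ℕ => -Real.log |infTwoPoint K ν 0 ((n : ℤ) • Pi.single (0 : Fin ν) (1 : ℤ))| / n) atTop :=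
    calc m = liminf (fun n : ℕ => m - Real.log C / n) atTop := htend.liminf_eq.symm
      _ ≤ _ := liminf_le_liminf hev hbbdd hbdd.isCoboundedUnder_ge
  unfold invCorrLength
  exact key

/-- Hence the tree's axis correlation length is dominated: `invCorrLength G_K ≥ log(1/(2ν·u(K)))` on Lieb's star
(`0 < 2ν·u(K) < 1`, `K > 0`, `ν ≥ 1`). [cite: Lieb1980, Theorem 4; FriedliVelenik2017, §3.10.7] -/
theorem neg_log_le_invCorrLength_of_besselRatio [NeZero ν] {K : ℝ} (hK : 0 < K)
    (hb1 : 2 * ν * besselRatio K < 1) :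
    -Real.log (2 * ν * besselRatio K) ≤ invCorrLength fun x : Site ν => infTwoPoint K ν 0 x := by
  have hu0 : 0 < besselRatio K := div_pos (besselI_pos hK 1) (besselI_pos hK 0)
  have hν : (0 : ℝ) < ν := by exact_mod_cast Nat.pos_of_ne_zero (NeZero.ne ν)
  have hb0 : 0 < 2 * ν * besselRatio K := by positivity
  have h := (ofReal_le_massGap_of_besselRatio hK.le hb0 hb1).trans (massGap_le_ofReal_invCorrLength hK)
  have hnn : 0 ≤ invCorrLength fun x : Site ν => infTwoPoint K ν 0 x := by
    refine le_liminf_of_le ?_ (Filter.Eventually.of_forall fun n => (neg_log_infTwoPoint_axis_div_mem_Icc hK n).1)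
    exact IsBoundedUnder.isCoboundedUnder_ge (isBoundedUnder_of ⟨-Real.log (besselRatio K),
      fun n => (neg_log_infTwoPoint_axis_div_mem_Icc hK n).2⟩)
  exact (ENNReal.ofReal_le_ofReal_iff hnn).1 h

/-- … and the axis correlation length of the comparison model lies in the same closed-form window as `1/massGap`:
`0 ≤ invCorrLength G_K ≤ log(I₀(K)/I₁(K))` for every `K > 0`. [cite: Ginibre1970, Prop. 3 with Example 4 (plane rotators); FriedliVelenik2017, §3.10.7] -/
theorem invCorrLength_infTwoPoint_mem_Icc [NeZero ν] {K : ℝ} (hK : 0 < K) :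
    invCorrLength (fun x : Site ν => infTwoPoint K ν 0 x) ∈ Set.Icc 0 (-Real.log (besselRatio K)) := by
  have hbdd : IsBoundedUnder (· ≤ ·) atTop (fun n : ℕ =>
      -Real.log |infTwoPoint K ν 0 ((n : ℤ) • Pi.single (0 : Fin ν) (1 : ℤ))| / n) :=
    isBoundedUnder_of ⟨-Real.log (besselRatio K), fun n => (neg_log_infTwoPoint_axis_div_mem_Icc hK n).2⟩
  have hbdd' : IsBoundedUnder (· ≥ ·) atTop (fun n : ℕ =>
      -Real.log |infTwoPoint K ν 0 ((n : ℤ) • Pi.single (0 : Fin ν) (1 : ℤ))| / n) :=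
    isBoundedUnder_of ⟨0, fun n => (neg_log_infTwoPoint_axis_div_mem_Icc hK n).1⟩
  constructor
  · exact le_liminf_of_le hbdd.isCoboundedUnder_ge
      (Filter.Eventually.of_forall fun n => (neg_log_infTwoPoint_axis_div_mem_Icc hK n).1)
  · exact liminf_le_of_frequently_le
      (Filter.Eventually.of_forall fun n => (neg_log_infTwoPoint_axis_div_mem_Icc hK n).2).frequently hbdd'

end Axis

end PlaneRotator

end Literature.Probability.LatticeModels
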